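import Summits.HodgeConjecture.HodgeConjecture.Theorems.NikulinTwinTransportHodgeSimilitudeAlgebraicDirect

/-!
# Route NikulinTwinTransport · crux `HodgeSimilitudeAlgebraic` (stmt-HodgeConjecture-13676) —
# squarefree multipliers: the crux = Buskin's item ∧ the open part, with no other debt

Complement to `NikulinTwinTransportHodgeSimilitudeAlgebraicDirect` (the crux at multiplier `c` IS
the lattice twin transport at multiplier `c`, modulo `Huybrechts_K3_marking_exists` /
`Huybrechts_K3_hodgeTypes_H2`). Since the set of multipliers at which the crux holds is a union of
square classes of `ℚ_{>0}` (`simAlgAt_div_sq`, `simAlgAt_mul_sq`), SQUAREFREE integer multipliers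
suffice — still with no Buskin, no composition of correspondences, no period surjectivity — and the
crux splits cleanly:

* `hodgeSimilitudeAlgebraic_of_squarefree_ratTwinTransportAt` — the crux from twin transport for
  the rational `n`-similitudes of `Λ_{K3}`, `n` squarefree, and the marking fact;
* `hodgeSimilitudeAlgebraic_iff_isometry_and_squarefree` — THE CRUX ⟺ the route item
  `HodgeIsometryAlgebraic` (stmt-HodgeConjecture-13675: Buskin 2019, Thm. 1.1, a PUBLISHED theorem)
  ∧ twin transport at every squarefree `n ≥ 2` (the OPEN content; `n = 2` is the target X in
  twin-transport form, `twinSimilitudeAlgebraic_iff_ratTwinTransportAt_two`).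

Sources: Buskin, J. reine angew. Math. 755 (2019) Thm. 1.1, §6.2; Varesco, Math. Z. 305 (2023) §2.
-/

noncomputable section

open CategoryTheory MonoidalCategory
open scoped Manifold
open Literature.AlgebraicGeometry.Motives Literature.AlgebraicGeometry.HodgeTheory
open Literature.AlgebraicGeometry.Surfaces Literature.Geometry.Kaehler
open Literature.AlgebraicTopology.SingularHomology
open Summit.HodgeConjecture.HodgeConjecture.Theses.NikulinTwinTransport

namespace Summit.HodgeConjecture.HodgeConjecture.Theorems.NikulinTwinTransport

/-! ### Local notations (verbatim those of the Anchors / Frontier / Primes files) -/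

/-- `MarkedK3[S, η, p, x]`: a marked K3 surface with period `x`. Local notation only. -/
local notation3 (prettyPrint := false) "MarkedK3[" S ", " η ", " p ", " x "]" =>
  (IsIntegralClass p ∧
    (∀ q : complexBetti S (2 * 2), IsIntegralClass q → ∃ n : ℤ, q = n • p) ∧
    (∀ c : complexBetti S (2 * 1), IsIntegralClass c ↔ ∃ v : K3Index → ℤ, η c = fun i => (v i : ℂ)) ∧
    (∀ a b : complexBetti S (2 * 1),
        cupProduct (rfl : 2 * 1 + 2 * 1 = 2 * 2) a b = k3Form (η a) (η b) • p) ∧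
    IsOfHodgeType 2 S (2 * 1) 2 0 (LinearEquiv.symm η x) ∧
    (∀ τ : complexBetti S (2 * 1), IsOfHodgeType 2 S (2 * 1) 2 0 τ → ∃ t : ℂ, τ = t • LinearEquiv.symm η x))

/-- `PeriodPt[x]`: a projective period point. Local notation only. -/
local notation3 (prettyPrint := false) "PeriodPt[" x "]" =>
  (k3Form x x = 0 ∧ 0 < (k3Form (star x) x).re ∧
    ∃ u : K3Index → ℤ, k3Form (fun i => (u i : ℂ)) x = 0 ∧ 0 < ∑ i, ∑ j, u i * k3Gram i j * u j)

/-- `Corr[μ, S, S', hS, hS' ; γ, y] = [γ]_* y`. Local notation only. -/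
local notation3 (prettyPrint := false) "Corr[" μ ", " S ", " S' ", " hS ", " hS' " ; " γ ", " y "]" =>
  complexGysin μ
    (IsSmoothProjective.tensor_holds (IsK3Surface.isSmoothProjective hS)
      (IsK3Surface.isSmoothProjective hS'))
    (IsK3Surface.isSmoothProjective hS) (SemiCartesianMonoidalCategory.fst S S')
    (rfl : 2 * 1 + 2 * 2 + 2 * 2 = 2 * 1 + 2 * (2 + 2))
    (cupProduct (rfl : 2 * 1 + 2 * 2 = 2 * 1 + 2 * 2)
      (complexBetti.map (SemiCartesianMonoidalCategory.snd S S') (2 * 1) y) γ)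

/-- `TwinTransportFor[M]`: the twin transport for the endomorphism `M` of `Λ_ℂ`. Local notation only. -/
local notation3 (prettyPrint := false) "TwinTransportFor[" M "]" =>
  ∀ (μ : OrientationFamily), μ.HasPoincareDuality →
    ∀ (S S' : SchemeOver ℂ) (hS : IsK3Surface S) (hS' : IsK3Surface S')
      (η : complexBetti S (2 * 1) ≃ₗ[ℂ] (K3Index → ℂ)) (p : complexBetti S (2 * 2))
      (x : K3Index → ℂ)
      (η' : complexBetti S' (2 * 1) ≃ₗ[ℂ] (K3Index → ℂ)) (p' : complexBetti S' (2 * 2))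
      (x' : K3Index → ℂ),
      MarkedK3[S, η, p, x] → PeriodPt[x] → MarkedK3[S', η', p', x'] → PeriodPt[x'] →
      (∃ t : ℂ, M x' = t • x) →
      ∃ γ ∈ algebraicClasses (MonoidalCategoryStruct.tensorObj S S') 2,
        ∀ y : complexBetti S' (2 * 1), η.symm (M (η' y)) = Corr[μ, S, S', hS, hS' ; γ, y]

/-- `RatTwinTransportAt[c]`: twin transport for every rational `c`-similitude of `Λ_ℂ` with rational
two-sided inverse. Local notation only, verbatim from the Frontier file. -/
local notation3 (prettyPrint := false) "RatTwinTransportAt[" c "]" =>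
  ∀ (M N : Module.End ℂ (K3Index → ℂ)),
    (∀ v : K3Index → ℤ, ∃ w : K3Index → ℚ, M (fun i => (v i : ℂ)) = fun i => (w i : ℂ)) →
    (∀ v : K3Index → ℤ, ∃ w : K3Index → ℚ, N (fun i => (v i : ℂ)) = fun i => (w i : ℂ)) →
    M * N = 1 → N * M = 1 → (∀ a b, k3Form (M a) (M b) = c * k3Form a b) → TwinTransportFor[M]

/-- `SimAlgAt[c]`: the crux at one multiplier `c : ℂ`. Local notation only, verbatim from the Primes
file (so that `SimAlgAt[(2 : ℂ)] ↔ TwinSimilitudeAlgebraic` and `HodgeSimilitudeAlgebraic ↔ ∀ r > 0,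
SimAlgAt[(r : ℂ)]` hold by `Iff.rfl`). -/
local notation3 (prettyPrint := false) "SimAlgAt[" c "]" =>
  ∀ (μ : OrientationFamily), μ.HasPoincareDuality →
    ∀ (S S' : SchemeOver ℂ)
      (hS : (IsSmoothProjective 2 S ∧ Subsingleton (structureSheafCohomology S.left 1) ∧
        ∃ (A : HodgeModel 2 S) (η : MForm 𝓘(ℝ, A.model) A.carrier ℂ 2),
          IsHolomorphicInCharts η ∧ ∀ x, η x ≠ 0))
      (hS' : (IsSmoothProjective 2 S' ∧ Subsingleton (structureSheafCohomology S'.left 1) ∧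
        ∃ (A : HodgeModel 2 S') (η : MForm 𝓘(ℝ, A.model) A.carrier ℂ 2),
          IsHolomorphicInCharts η ∧ ∀ x, η x ≠ 0))
      (p : complexBetti S (2 * 2)) (p' : complexBetti S' (2 * 2)),
      (IsIntegralClass p ∧ ∀ q : complexBetti S (2 * 2), IsIntegralClass q → ∃ n : ℤ, q = n • p) →
      (IsIntegralClass p' ∧
        ∀ q : complexBetti S' (2 * 2), IsIntegralClass q → ∃ n : ℤ, q = n • p') →
      ∀ (ψ : complexBetti S' (2 * 1) →ₗ[ℂ] complexBetti S (2 * 1)),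
        (∀ x, IsRationalClass x → IsRationalClass (ψ x)) →
        (∀ (i j : ℕ) x, IsOfHodgeType 2 S' (2 * 1) i j x → IsOfHodgeType 2 S (2 * 1) i j (ψ x)) →
        (∀ (x y : complexBetti S' (2 * 1)) (a : ℂ),
          cupProduct (rfl : 2 * 1 + 2 * 1 = 2 * 2) x y = a • p' →
            cupProduct (rfl : 2 * 1 + 2 * 1 = 2 * 2) (ψ x) (ψ y) = (c * a) • p) →
        ∃ γ ∈ algebraicClasses (MonoidalCategoryStruct.tensorObj S S') 2,
          ∀ x : complexBetti S' (2 * 1),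
            ψ x = complexGysin μ (IsSmoothProjective.tensor_holds hS.1 hS'.1) hS.1
              (SemiCartesianMonoidalCategory.fst S S')
              (rfl : 2 * 1 + 2 * 2 + 2 * 2 = 2 * 1 + 2 * (2 + 2))
              (cupProduct (rfl : 2 * 1 + 2 * 2 = 2 * 1 + 2 * 2)
                (complexBetti.map (SemiCartesianMonoidalCategory.snd S S') (2 * 1) x) γ)

/-! ### Squares upward; squarefree multipliers suffice -/

/-- **Squares upward.** If the crux holds at multiplier `m`, it holds at multiplier `m · b²` for
every rational `b ≠ 0` (`simAlgAt_div_sq` with `b⁻¹`). So the set of multipliers at which the crux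
holds is a union of square classes of `ℚ_{>0}`. [folklore] -/
theorem simAlgAt_mul_sq (m : ℂ) (b : ℚ) (hb : b ≠ 0) (hm : SimAlgAt[m]) :
    SimAlgAt[m * (b : ℂ) ^ 2] := by
  have h := simAlgAt_div_sq m b⁻¹ (inv_ne_zero hb) hm
  have hcast : m / ((b⁻¹ : ℚ) : ℂ) ^ 2 = m * (b : ℂ) ^ 2 := by
    rw [Rat.cast_inv, inv_pow, div_inv_eq_mul]
  rw [hcast] at h
  exact h

/-- **Squarefree multipliers suffice, without Buskin or composition**: twin transport for the
rational `n`-similitudes of `Λ_{K3}`, `n` a SQUAREFREE positive integer, gives the crux — every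
positive rational is `n · q²` with `n` squarefree (`Nat.sq_mul_squarefree_of_pos` on
`num r · den r`) and squares of rationals are free (`simAlgAt_div_sq`). [folklore] -/
theorem hodgeSimilitudeAlgebraic_of_squarefree_ratTwinTransportAt
    (hMk : Huybrechts_K3_marking_exists)
    (h : ∀ n : ℕ, 0 < n → Squarefree n → RatTwinTransportAt[((n : ℕ) : ℂ)]) :
    HodgeSimilitudeAlgebraic := by
  intro r hr
  have hnum : 0 < r.num := Rat.num_pos.mpr hr
  have htoNat : 0 < r.num.toNat := by omega
  obtain ⟨m, hm⟩ : ∃ m : ℕ, m = r.num.toNat * r.den := ⟨_, rfl⟩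
  have hmpos : 0 < m := hm ▸ Nat.mul_pos htoNat r.den_pos
  have hden : (r.den : ℚ) ≠ 0 := by exact_mod_cast r.den_ne_zero
  have hm' : ((m : ℕ) : ℚ) = r.num * r.den := by
    rw [hm, Nat.cast_mul]
    congr 1
    have h' : ((r.num.toNat : ℕ) : ℤ) = r.num := Int.toNat_of_nonneg hnum.le
    exact_mod_cast h'
  have hq : ((m : ℕ) : ℚ) / (r.den : ℚ) ^ 2 = r := by
    rw [hm', sq, mul_div_mul_right _ _ hden, Rat.num_div_den]
  -- `m = b² a` with `a` squarefree
  obtain ⟨a, b, ha, hb, hab, hsq⟩ := Nat.sq_mul_squarefree_of_pos hmpos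
  have hbQ : (b : ℚ) ≠ 0 := by exact_mod_cast hb.ne'
  -- the crux at the squarefree multiplier `a`
  have haS : SimAlgAt[(((a : ℕ) : ℚ) : ℂ)] :=
    simAlgAt_of_ratTwinTransportAt hMk (a : ℚ) (by exact_mod_cast ha)
      (by rw [Rat.cast_natCast]; exact h a ha hsq)
  rw [Rat.cast_natCast] at haS
  -- `r = a / (den / b)²`
  have hq' : ((a : ℕ) : ℚ) / ((r.den : ℚ) / (b : ℚ)) ^ 2 = r := by
    have hmab : ((m : ℕ) : ℚ) = ((b : ℕ) : ℚ) ^ 2 * ((a : ℕ) : ℚ) := by exact_mod_cast hab.symm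
    calc ((a : ℕ) : ℚ) / ((r.den : ℚ) / (b : ℚ)) ^ 2
        = ((b : ℕ) : ℚ) ^ 2 * ((a : ℕ) : ℚ) / (r.den : ℚ) ^ 2 := by
          rw [div_pow, div_div_eq_mul_div]
          ring
      _ = r := by rw [← hmab]; exact hq
  have hcast : ((a : ℕ) : ℂ) / ((((r.den : ℚ) / (b : ℚ) : ℚ)) : ℂ) ^ 2 = (r : ℂ) := by
    have h2 := congrArg (Rat.cast : ℚ → ℂ) hq'
    simpa only [Rat.cast_div, Rat.cast_pow, Rat.cast_natCast] using h2
  have key := simAlgAt_div_sq ((a : ℕ) : ℂ) ((r.den : ℚ) / (b : ℚ)) (div_ne_zero hden hbQ) haS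
  rw [hcast] at key
  exact key

/-- **THE CRUX = BUSKIN'S ITEM ∧ TWIN TRANSPORT AT THE SQUAREFREE MULTIPLIERS `n ≥ 2`**, modulo
`Huybrechts_K3_marking_exists` and `Huybrechts_K3_hodgeTypes_H2` only. The first conjunct is the
route item `HodgeIsometryAlgebraic` (stmt-HodgeConjecture-13675: Buskin 2019, Thm. 1.1, a published
theorem); the second is the open content, one squarefree integer at a time (`n = 2` being X in
twin-transport form, `twinSimilitudeAlgebraic_iff_ratTwinTransportAt_two`). No composition of
correspondences, no moving lemma, no period surjectivity enters. [cite: Buskin2019, Thm. 1.1 and §6.2]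
[cite: Varesco2023, §2] -/
theorem hodgeSimilitudeAlgebraic_iff_isometry_and_squarefree (hMk : Huybrechts_K3_marking_exists)
    (hHT : Huybrechts_K3_hodgeTypes_H2) :
    HodgeSimilitudeAlgebraic ↔
      (HodgeIsometryAlgebraic ∧
        ∀ n : ℕ, 2 ≤ n → Squarefree n → RatTwinTransportAt[((n : ℕ) : ℂ)]) := by
  constructor
  · intro hX
    have hnat := (hodgeSimilitudeAlgebraic_iff_nat_ratTwinTransportAt hMk hHT).1 hX
    refine ⟨(hodgeIsometryAlgebraic_iff_ratTwinTransportAt_one hMk hHT).2 ?_,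
      fun n hn _ => hnat n (by omega)⟩
    have h1 := hnat 1 one_pos
    rw [Nat.cast_one] at h1
    exact h1
  · rintro ⟨hB, h⟩
    refine hodgeSimilitudeAlgebraic_of_squarefree_ratTwinTransportAt hMk fun n hn hsq => ?_
    rcases Nat.lt_or_ge n 2 with hlt | hge
    · obtain rfl : n = 1 := by omega
      rw [Nat.cast_one]
      exact (hodgeIsometryAlgebraic_iff_ratTwinTransportAt_one hMk hHT).1 hB
    · exact h n hge hsq

end Summit.HodgeConjecture.HodgeConjecture.Theorems.NikulinTwinTransport

end
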